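import Summits.ValiantsHypothesis.ValiantsHypothesis.Theorems.LacunarySymmetroidMatrixDescartesWLawArrowLetters

/-!
# `MatrixDescartes` (stmt-ValiantsHypothesis-18050) — THE W-LAW ROWS AT ALL SIZES: `w(n) ≥ 4n − 2` for EVERY `n`
# (the «bordering lemma» as an explicit ARROWHEAD construction)

HONEST FRAMING.  Cell `pub-symmetroid`, seat `val-sym-mdr-p2` (gen 8); helper file `--supports` the crux
`Theses.LacunarySymmetroid.MatrixDescartes` (OPEN), NO closure claim.  LOWER-bound bookkeeping for the typed W-law rows
`WLawAt n B` of `…WLawDefs` (W-configuration `X^e J + X^{d₁} P₁ + X^{d₂} P₂ + X^{d₃} Q`, `d₂ < d₁ < e < d₃`, `J` real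
symmetric, `P₁, P₂, Q ⪰ 0`; `w(n) := min {B | WLawAt n B}`).  Kernel so far: `w(1) = 2`, `w(2) = 6`, `w(3) ≥ 10`,
`w(4) ≥ 14`, `w(5) ≥ 18` by zero forcing and COUPLED BORDERS found numerically (`…WLawThreeWitness`,
`…WLawFourWitness`, `…WLawFiveWitness`), and `w(n) ≥ 10⌊n/3⌋ + (0,2,6)[n mod 3]` by block sums (`…WLawBlockSum`).
THIS FILE: **`w(n) ≥ 4n − 2` for every `n ≥ 1`** (`four_mul_sub_two_le_of_wLawAt_all`), by an explicit construction
with a transparent mechanism.  Nothing here bears on `MatrixDescartes` in its window (an UPPER bound at fat formats),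
on `stub_twoSided`, `DoorA26` / `DoorA34`, the census registers, or `VP ≠ VNP`.

THE CONSTRUCTION (support `(e; d₁, d₂; d₃) = (3; 2, 0; 5)`, size `k + 1`, index `Fin k ⊕ Fin 1`; scales `Ξᵢ > 0`,
amplitudes `Uᵢ > 0`, a slack `s > 0`).  ARROWHEAD letters — diagonal blocks plus one bordered row/column:
* `P₂ = [[diag(5Ξᵢ⁷/Uᵢ), (−5Ξᵢ⁵)ᵢ], [(−5Ξᵢ⁵)ᵢᵀ, ∑ 5UᵢΞᵢ³ + 1]]`, `P₁ = [[diag(25Ξᵢ⁵/Uᵢ), (−25Ξᵢ³)ᵢ], [·ᵀ, ∑ 25UᵢΞᵢ]]`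
  (positive semidefinite: the Schur complements of the diagonal blocks are `1` and `0`),
* `J = diag(5Ξᵢ⁴/Uᵢ, …, −1 − 5∑Uᵢ)` (DIAGONAL, exactly one negative entry), `Q = diag(Ξᵢ²/Uᵢ, …, s)` (diagonal, PSD).
So the index-one direction sits in the corner and the coupling runs ONLY through the two letters below the pivot.
By the Schur complement (`Matrix.det_fromBlocks₁₁`), for `x > 0`,
`det(P₂ + x²P₁ + x³J + x⁵Q) = (∏ᵢ mᵢ(x)) · x³ · (x⁻³ − 1 + ∑ᵢ Uᵢ φ(x/Ξᵢ) + s x²)`, `mᵢ(x) > 0`,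
with the reference block shape `φ(y) = 5y²(1 − 5y + 5y² − y³)/(5 + 25y² + 5y³ + y⁵)` of the kit file
(`det_pencil_eval`): each block is «flattened» (its contribution is bounded, `→ 0` to the left and `→ −5Uᵢ` to the
right of its window) and inside its window it crosses the running level FOUR times (`φ` has the signs `+, −, +, −` at
`1/10, 1/2, 2, 10`).  The kit's soft induction (`WLawArrow.model_alternates`: new scale `Ξ' → ∞`, finitely many
eventual sign conditions) gives `4k + 2` alternating signs of the model; the slack `s x²` (chosen small, then `x`
large) adds one more sign change on the far right; the intermediate value theorem
(`SymmetroidDescartes.le_card_posRoots_of_alternating`) turns `4k + 3` alternating signs into `4k + 2 = 4(k+1) − 2`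
distinct positive roots.  Reindexing `Fin k ⊕ Fin 1 ≃ Fin (k+1)` (`finSumFinEquiv`) puts the witness in the format
of `WLawAt`.

CONSEQUENCES.  `exists_wConfig_arrow (k)`: an explicit `(k+1) × (k+1)` W-configuration on `(3; 2, 0; 5)` with at
least `4k + 2` distinct positive determinant roots; `four_mul_sub_two_le_of_wLawAt_all : 1 ≤ n → WLawAt n B →
4n − 2 ≤ B` (supersedes the `n ≤ 5` row of `…WLawFiveWitness` and the `(10/3)·n` row of `…WLawBlockSum`);
`not_wLawAt_four_mul_sub_three : 1 ≤ n → ¬ WLawAt n (4n − 3)`.  The located pattern «4n − 2» (desk R1852/R1861) is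
thus a LOWER bound at every size; whether `w(n) = 4n − 2` (an upper bound linear in the size for this four-letter
format) is OPEN — the constrained Descartes ceiling on `(3; 2, 0; 5)` is `2, 6, 12, 16, 22, …`.

[folklore] Elementary linear algebra (Schur complement) and real analysis over Mathlib; tree inputs
`WLawTwoWitness.eval_det_pencil₄`, `SymmetroidDescartes.le_card_posRoots_of_alternating`, the kit
`…WLawArrowKit` (scalar model) and `…WLawArrowLetters` (letters, `det_pencil_eval`).  Axioms `propext`, `Classical.choice`, `Quot.sound`.
-/

set_option linter.dupNamespace false

namespace Summit.ValiantsHypothesis.ValiantsHypothesis.Theorems.LacunarySymmetroidMatrixDescartes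

open scoped BigOperators Topology Matrix
open Filter Matrix Polynomial

namespace WLawArrow

/-- The reference block shape (as in the kit file; local notation, no definition). -/
local notation3 (prettyPrint := false) "φ[" y "]" =>
  (5 * (y : ℝ) ^ 2 * (1 - 5 * (y : ℝ) + 5 * (y : ℝ) ^ 2 - (y : ℝ) ^ 3))
    / (5 + 25 * (y : ℝ) ^ 2 + 5 * (y : ℝ) ^ 3 + (y : ℝ) ^ 5)

/-- The scalar model (as in the kit file; local notation, no definition). -/
local notation3 (prettyPrint := false) "M[" Ξ ", " U "](" x ")" =>
  ((x : ℝ)⁻¹ ^ 3 - 1 + ∑ i, (U : Fin _ → ℝ) i * φ[(x : ℝ) / (Ξ : Fin _ → ℝ) i])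

/-- The arrowhead letter `P₂` (local notation, no definition). -/
local notation3 (prettyPrint := false) "P₂blk[" Ξ ", " U "]" =>
  Matrix.fromBlocks (diagonal fun i => 5 * (Ξ : Fin _ → ℝ) i ^ 7 / (U : Fin _ → ℝ) i)
    (Matrix.of fun (i : Fin _) (_ : Fin 1) => -(5 * (Ξ : Fin _ → ℝ) i ^ 5))
    (Matrix.of fun (_ : Fin 1) (i : Fin _) => -(5 * (Ξ : Fin _ → ℝ) i ^ 5))
    (Matrix.of fun (_ _ : Fin 1) => (∑ i, 5 * (U : Fin _ → ℝ) i * (Ξ : Fin _ → ℝ) i ^ 3) + 1)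

/-- The arrowhead letter `P₁` (local notation, no definition). -/
local notation3 (prettyPrint := false) "P₁blk[" Ξ ", " U "]" =>
  Matrix.fromBlocks (diagonal fun i => 25 * (Ξ : Fin _ → ℝ) i ^ 5 / (U : Fin _ → ℝ) i)
    (Matrix.of fun (i : Fin _) (_ : Fin 1) => -(25 * (Ξ : Fin _ → ℝ) i ^ 3))
    (Matrix.of fun (_ : Fin 1) (i : Fin _) => -(25 * (Ξ : Fin _ → ℝ) i ^ 3))
    (Matrix.of fun (_ _ : Fin 1) => ∑ i, 25 * (U : Fin _ → ℝ) i * (Ξ : Fin _ → ℝ) i)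

/-- The diagonal letter `J` (local notation, no definition). -/
local notation3 (prettyPrint := false) "Jblk[" Ξ ", " U "]" =>
  Matrix.fromBlocks (diagonal fun i => 5 * (Ξ : Fin _ → ℝ) i ^ 4 / (U : Fin _ → ℝ) i) 0 0
    (Matrix.of fun (_ _ : Fin 1) => -1 - 5 * ∑ i, (U : Fin _ → ℝ) i)

/-- The diagonal letter `Q` (local notation, no definition). -/
local notation3 (prettyPrint := false) "Qblk[" Ξ ", " U ", " s "]" =>
  Matrix.fromBlocks (diagonal fun i => (Ξ : Fin _ → ℝ) i ^ 2 / (U : Fin _ → ℝ) i) 0 0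
    (Matrix.of fun (_ _ : Fin 1) => (s : ℝ))

/-- Reindexing `Fin k ⊕ Fin 1 ≃ Fin (k + 1)` (local notation). -/
local notation3 (prettyPrint := false) "rx[" A "]" => Matrix.reindex finSumFinEquiv finSumFinEquiv A


/-! ## The end step: a small slack adds one sign change on the far right -/

/-- Consecutive values of an alternating list have negative product. [bookkeeping] -/
theorem prod_neg_of_alt {m : ℕ} (f : ℝ → ℝ) (σ : Fin (m + 1) → ℝ)
    (hsign : ∀ j : Fin (m + 1), 0 < (-1 : ℝ) ^ ((j : ℕ) + 1) * f (σ j)) (j : Fin m) :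
    f (σ j.castSucc) * f (σ j.succ) < 0 := by
  have h1 := hsign j.castSucc
  have h2 := hsign j.succ
  simp only [Fin.val_castSucc, Fin.val_succ] at h1 h2
  rw [pow_succ] at h2
  rcases neg_one_pow_eq_or ℝ ((j : ℕ) + 1) with h | h
  · rw [h] at h1 h2
    exact mul_neg_of_pos_of_neg (by linarith) (by linarith)
  · rw [h] at h1 h2
    exact mul_neg_of_neg_of_pos (by linarith) (by linarith)

/-- **The slack.**  Given the alternating data of the scalar model, some `s > 0` keeps all the signs of
`M + s x²` at the listed points and some point `X` beyond the list has `M(X) + s X² > 0`. [folklore] -/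
theorem end_step {k m : ℕ} (Ξ U : Fin k → ℝ) (hΞ : ∀ i, 0 < Ξ i)
    (σ : Fin (m + 1) → ℝ) (hsign : ∀ j : Fin (m + 1), 0 < (-1 : ℝ) ^ ((j : ℕ) + 1) * M[Ξ, U](σ j)) :
    ∃ s X : ℝ, 0 < s ∧ σ 0 < X ∧ 0 < M[Ξ, U](X) + s * X ^ 2 ∧
      ∀ j : Fin (m + 1), 0 < (-1 : ℝ) ^ ((j : ℕ) + 1) * (M[Ξ, U](σ j) + s * σ j ^ 2) := by
  have E : ∀ j : Fin (m + 1), ∀ᶠ s : ℝ in 𝓝[>] 0,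
      0 < (-1 : ℝ) ^ ((j : ℕ) + 1) * (M[Ξ, U](σ j) + s * σ j ^ 2) := by
    intro j
    have ht : Tendsto (fun s : ℝ => (-1 : ℝ) ^ ((j : ℕ) + 1) * (M[Ξ, U](σ j) + s * σ j ^ 2)) (𝓝[>] 0)
        (𝓝 ((-1 : ℝ) ^ ((j : ℕ) + 1) * (M[Ξ, U](σ j) + 0 * σ j ^ 2))) :=
      tendsto_nhdsWithin_of_tendsto_nhds (((tendsto_id.mul_const _).const_add _).const_mul _)
    rw [zero_mul, add_zero] at ht
    exact ht.eventually_const_lt (hsign j)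
  obtain ⟨s, hs, hsigns⟩ :=
    ((eventually_mem_nhdsWithin (a := (0 : ℝ)) (s := Set.Ioi 0)).and (eventually_all.2 E)).exists
  rw [Set.mem_Ioi] at hs
  have hT : Tendsto (fun x : ℝ => M[Ξ, U](x) + s * x ^ 2) atTop atTop :=
    (model_tendsto_atTop Ξ U hΞ).add_atTop ((tendsto_pow_atTop two_ne_zero).const_mul_atTop hs)
  obtain ⟨X, hX1, hX2⟩ := ((hT.eventually_gt_atTop 0).and (eventually_gt_atTop (σ 0))).exists
  exact ⟨s, X, hs, hX2, hX1, hsigns⟩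

/-- Root counting from a strictly DECREASING list of positive points with alternating signs (the tree lemma
`SymmetroidDescartes.le_card_posRoots_of_alternating` read backwards). [folklore] -/
theorem le_card_posRoots_of_alternating_anti (p : ℝ[X]) (N : ℕ) (ρ : Fin (N + 1) → ℝ)
    (hρ : StrictAnti ρ) (hpos : ∀ j, 0 < ρ j)
    (halt : ∀ j : Fin N, p.eval (ρ j.castSucc) * p.eval (ρ j.succ) < 0) :
    N ≤ (p.roots.toFinset.filter (fun t => 0 < t)).card := by
  refine Summit.ValiantsHypothesis.ValiantsHypothesis.Theorems.SymmetroidDescartes.le_card_posRoots_of_alternating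
    p N (fun j => ρ (Fin.rev j)) (hρ.comp Fin.rev_strictAnti) (fun j => hpos _) fun j => ?_
  have h := halt (Fin.rev j)
  rw [Fin.rev_castSucc, Fin.rev_succ, mul_comm]
  exact h

/-! ## The theorems -/

/-- **W-CONFIGURATIONS WITH `4k + 2` POSITIVE ROOTS IN EVERY SIZE `k + 1`.**  For every `k` there is an explicit
`(k+1) × (k+1)` W-configuration on the support `(3; 2, 0; 5)` (arrowhead letters) whose determinant has at least
`4k + 2 = 4(k+1) − 2` distinct positive roots. [folklore] -/
theorem exists_wConfig_arrow (k : ℕ) :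
    ∃ (J P₁ P₂ Q : Matrix (Fin (k + 1)) (Fin (k + 1)) ℝ), J.IsSymm ∧ P₁.PosSemidef ∧ P₂.PosSemidef ∧
      Q.PosSemidef ∧
      4 * k + 2 ≤ ((Matrix.det (((X : ℝ[X]) ^ 3) • J.map Polynomial.C + ((X : ℝ[X]) ^ 2) • P₁.map Polynomial.C
        + ((X : ℝ[X]) ^ 0) • P₂.map Polynomial.C + ((X : ℝ[X]) ^ 5) • Q.map Polynomial.C)).roots.toFinset.filter
          (fun t => 0 < t)).card := by
  obtain ⟨Ξ, U, σ, hΞ, hU, hanti, hpos, hsign⟩ := model_alternates k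
  obtain ⟨s, Xr, hs, hX, hXval, hsigns⟩ := end_step Ξ U hΞ σ hsign
  refine ⟨rx[Jblk[Ξ, U]], rx[P₁blk[Ξ, U]], rx[P₂blk[Ξ, U]], rx[Qblk[Ξ, U, s]], isSymm_J Ξ U,
    posSemidef_P₁ Ξ U hΞ hU, posSemidef_P₂ Ξ U hΞ hU, posSemidef_Q Ξ U hU hs.le, ?_⟩
  -- the decreasing list `X > σ 0 > σ 1 > …` of `4k + 3` points
  have hρpos : ∀ j, 0 < (vecCons Xr σ) j := by
    intro j
    refine Fin.cases ?_ (fun i => ?_) j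
    · simpa using (hpos 0).trans hX
    · simpa using hpos i
  refine le_card_posRoots_of_alternating_anti _ (4 * k + 1 + 1) (vecCons Xr σ) (hanti.vecCons hX) hρpos
    fun j => ?_
  refine Fin.cases ?_ (fun i => ?_) j
  · -- the far-right pair `X, σ 0`
    have h0 := hsigns 0
    simp only [Fin.val_zero, zero_add, pow_one] at h0
    rw [Fin.castSucc_zero, Matrix.cons_val_zero, Fin.succ_zero_eq_one, Matrix.cons_val_one]
    exact eval_mul_eval_neg Ξ U hΞ hU s ((hpos 0).trans hX) (hpos 0) (mul_neg_of_pos_of_neg hXval (by linarith))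
  · rw [← Fin.succ_castSucc, Matrix.cons_val_succ, Matrix.cons_val_succ]
    exact eval_mul_eval_neg Ξ U hΞ hU s (hpos _) (hpos _)
      (prod_neg_of_alt (fun x => M[Ξ, U](x) + s * x ^ 2) σ hsigns i)

end WLawArrow

/-- **LOWER BOUND FOR THE W-LAW ROWS AT EVERY SIZE: `w(n) ≥ 4n − 2`.**  If `WLawAt n B` holds (`n ≥ 1`) then
`4n − 2 ≤ B` — the located pattern «4n − 2» (coupled borders, kernel through `n = 5` in `…WLawFiveWitness`) is a
lower bound at EVERY size, by the explicit arrowhead construction of this file. [folklore] -/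
theorem four_mul_sub_two_le_of_wLawAt_all {n B : ℕ} (hn : 1 ≤ n) (h : WLawAt n B) : 4 * n - 2 ≤ B := by
  obtain ⟨k, rfl⟩ : ∃ k, n = k + 1 := ⟨n - 1, by omega⟩
  obtain ⟨J, P₁, P₂, Q, hJ, hP₁, hP₂, hQ, hA⟩ := WLawArrow.exists_wConfig_arrow k
  have hB := h 3 2 0 5 J P₁ P₂ Q hJ hP₁ hP₂ hQ (by norm_num) (by norm_num) (by norm_num)
  omega

/-- Hence `¬ WLawAt n (4n − 3)` for every `n ≥ 1`. [bookkeeping] -/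
theorem not_wLawAt_four_mul_sub_three {n : ℕ} (hn : 1 ≤ n) : ¬ WLawAt n (4 * n - 3) := by
  intro h
  have := four_mul_sub_two_le_of_wLawAt_all hn h
  omega

/-- Census words: for every `n ≥ 1` some `n × n` W-configuration on the support `(3; 2, 0; 5)` has at least
`4n − 2` distinct positive determinant roots. [folklore] -/
theorem exists_wConfig_four_mul_sub_two {n : ℕ} (hn : 1 ≤ n) :
    ∃ (J P₁ P₂ Q : Matrix (Fin n) (Fin n) ℝ), J.IsSymm ∧ P₁.PosSemidef ∧ P₂.PosSemidef ∧ Q.PosSemidef ∧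
      4 * n - 2 ≤ ((Matrix.det (((X : ℝ[X]) ^ 3) • J.map Polynomial.C + ((X : ℝ[X]) ^ 2) • P₁.map Polynomial.C
        + ((X : ℝ[X]) ^ 0) • P₂.map Polynomial.C + ((X : ℝ[X]) ^ 5) • Q.map Polynomial.C)).roots.toFinset.filter
          (fun t => 0 < t)).card := by
  obtain ⟨k, rfl⟩ : ∃ k, n = k + 1 := ⟨n - 1, by omega⟩
  obtain ⟨J, P₁, P₂, Q, hJ, hP₁, hP₂, hQ, hA⟩ := WLawArrow.exists_wConfig_arrow k
  exact ⟨J, P₁, P₂, Q, hJ, hP₁, hP₂, hQ, by omega⟩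

end Summit.ValiantsHypothesis.ValiantsHypothesis.Theorems.LacunarySymmetroidMatrixDescartes
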